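import Summits.QuantumFields.YangMills.Theorems.SqueezedSkewnessTorusKLSiteTraces
import Summits.QuantumFields.YangMills.Theorems.SqueezedSkewnessTorusKLComplexBridge
import Summits.QuantumFields.YangMills.Theorems.SqueezedSkewnessTorusKLAdaptedBasis
import Literature.Analysis.OperatorTheory.CompactSelfAdjointEigenbasis
import HarnessLib

/-!
# ENGINE-KL layer (K4c) for `SqueezedSkewness.TorusKL` (stmt-QuantumFields-23204, stub `stub_torusMixtureData`): THE COMPLEX SPECTRAL
# PACKAGE OF THE `Fin`-TORUS on `H = L²(slices; ℂ)`

§1 the complex transfer operator `A'` (kernel `finTorusSliceKernel`; self-adjoint, compact, positive by Lüscher positivity transferred through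
`ComplexBridge`), the unitary slice translations `U'_v` commuting with it and the bond operators `X'_p` (kernel `siteBondKernel ρ β p`,
`X'_{p+v} U'_v = U'_v X'_p`), all complexifications (`T' J = J T`) of the real operators of layers K1–K3, together with a real eigenbasis
`A bᵢ = λᵢ bᵢ`; §2 regrouping of spectral sums over the eigenvalue classes `c > 0` (`HasSum.tsum_fiberwise` along `i ↦ λᵢ`); §3 per class a
finite orthonormal family of JOINT eigenvectors (`A' e = c e`, `U'_{v(γ)} e = χ_q(γ) e`, bicharacter of `(ℤ/S)³`;
`AdaptedBasis.exists_adapted_orthonormal_family` on `span_ℂ {J bᵢ : λᵢ = c}`) and the trace formula, the one-point functions and the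
site-resolved two-point function of layer K3 as `HasSum`s over the classes.  Seat `ym-line-fcl-p3` g16; route-independent imports;
`[folklore]` (Lüscher 1977; Reed–Simon I §VI.6; Montvay–Münster §3.2.6); nothing about a summit, NT or the mass gap is proved.
-/

set_option autoImplicit false

noncomputable section
open MeasureTheory Filter Function
open scoped InnerProductSpace ComplexConjugate ENNReal
open Literature.MathematicalPhysics.QuantumFieldTheory Literature.Barriers.QuantumFields
open Literature.Analysis.OperatorTheory
open Summit.QuantumFields.YangMills.Theorems.TorusKL.ComplexBridge

namespace Summit.QuantumFields.YangMills.Theorems.TorusKL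

variable {S : ℕ} [NeZero S] {G : Type*} [Group G] [TopologicalSpace G] [IsTopologicalGroup G] [CompactSpace G] [MeasurableSpace G]
  [BorelSpace G] [SecondCountableTopology G] {N : ℕ} (ρ : G →* Matrix (Fin N) (Fin N) ℂ) (β : ℝ)

/-! ## §1 The complex operators -/

/-- **COMPLEX TRANSFER OPERATOR, TRANSLATIONS AND BOND OPERATORS, with a real eigenbasis.**  On `H = L²(slices; ℂ)`: `A'` (kernel
`finTorusSliceKernel ρ β`; self-adjoint, compact, positive), `U'_v` (slice translations; a norm-preserving representation of the spatial
torus commuting with `A'`), `X'_p` (kernel `siteBondKernel ρ β p`; `X'_{p+v} U'_v = U'_v X'_p`), TOGETHER WITH the real operators `A`, `X_p` of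
layers K1–K3, an orthonormal eigenbasis `A bᵢ = λᵢ bᵢ` of `L²(slices; ℝ)` (`λᵢ ≥ 0`, `Σ λᵢ² < ∞`, `Z(m+2) = Σ λᵢ^{m+2}`) and the
complexification relations `A' (J f) = J (A f)`, `X'_p (J f) = J (X_p f)`, `U'_v (J f) =ᵐ …`. [cite: Luscher1977] [cite: ReedSimonI1980, Thm VI.23] -/
theorem exists_complex_operators (hρ : Continuous ρ) (hρu : ∀ g, ρ g ∈ Matrix.unitaryGroup (Fin N) ℂ) (hβ : 0 ≤ β) :
    ∃ (A : Lp ℝ 2 (Measure.pi fun _ : FinSpatialSite S S S × Fin 3 => haarProbability G) →L[ℝ]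
        Lp ℝ 2 (Measure.pi fun _ : FinSpatialSite S S S × Fin 3 => haarProbability G))
      (X : FinSpatialSite S S S → Lp ℝ 2 (Measure.pi fun _ : FinSpatialSite S S S × Fin 3 => haarProbability G) →L[ℝ]
        Lp ℝ 2 (Measure.pi fun _ : FinSpatialSite S S S × Fin 3 => haarProbability G))
      (ι : Set (Lp ℝ 2 (Measure.pi fun _ : FinSpatialSite S S S × Fin 3 => haarProbability G))) (_ : Countable ι)
      (b : HilbertBasis ι ℝ (Lp ℝ 2 (Measure.pi fun _ : FinSpatialSite S S S × Fin 3 => haarProbability G))) (lam : ι → ℝ)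
      (A' : Lp ℂ 2 (Measure.pi fun _ : FinSpatialSite S S S × Fin 3 => haarProbability G) →L[ℂ]
        Lp ℂ 2 (Measure.pi fun _ : FinSpatialSite S S S × Fin 3 => haarProbability G))
      (U' : FinSpatialSite S S S → Lp ℂ 2 (Measure.pi fun _ : FinSpatialSite S S S × Fin 3 => haarProbability G) →L[ℂ]
        Lp ℂ 2 (Measure.pi fun _ : FinSpatialSite S S S × Fin 3 => haarProbability G))
      (X' : FinSpatialSite S S S → Lp ℂ 2 (Measure.pi fun _ : FinSpatialSite S S S × Fin 3 => haarProbability G) →L[ℂ]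
        Lp ℂ 2 (Measure.pi fun _ : FinSpatialSite S S S × Fin 3 => haarProbability G)),
      -- real transfer operator, bond operators, eigenbasis
      (∀ φ, (A φ : (FinSpatialSite S S S × Fin 3 → G) → ℝ) =ᵐ[Measure.pi fun _ : FinSpatialSite S S S × Fin 3 => haarProbability G]
        fun x => ∫ y, finTorusSliceKernel ρ β x y * φ y ∂(Measure.pi fun _ : FinSpatialSite S S S × Fin 3 => haarProbability G)) ∧
      (∀ p φ, (X p φ : (FinSpatialSite S S S × Fin 3 → G) → ℝ) =ᵐ[Measure.pi fun _ : FinSpatialSite S S S × Fin 3 => haarProbability G]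
        fun u => ∫ u', siteBondKernel ρ β p u u' * φ u' ∂(Measure.pi fun _ : FinSpatialSite S S S × Fin 3 => haarProbability G)) ∧
      (∀ i, A (b i) = lam i • b i) ∧ (∀ i, 0 ≤ lam i) ∧ Summable (fun i => lam i ^ 2) ∧
      (∀ m : ℕ, HasSum (fun i => lam i ^ (m + 2)) (wilsonFinTorusPartition ρ β S S S (m + 2))) ∧
      (∀ f f', ⟪A f, f'⟫_ℝ = ⟪f, A f'⟫_ℝ) ∧
      -- complex operators
      IsSelfAdjoint A' ∧ IsCompactOperator A' ∧
      (∀ g, 0 ≤ RCLike.re ⟪A' g, g⟫_ℂ) ∧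
      U' 0 = 1 ∧ (∀ v w, U' (v + w) = U' v * U' w) ∧ (∀ v g, ‖U' v g‖ = ‖g‖) ∧ (∀ v, A' * U' v = U' v * A') ∧
      (∀ p v, X' (p + v) * U' v = U' v * X' p) ∧
      -- complexification relations
      (∀ g, (A' g : (FinSpatialSite S S S × Fin 3 → G) → ℂ) =ᵐ[Measure.pi fun _ : FinSpatialSite S S S × Fin 3 => haarProbability G]
        fun x => ∫ y, ((finTorusSliceKernel ρ β x y : ℝ) : ℂ) * g y ∂(Measure.pi fun _ : FinSpatialSite S S S × Fin 3 => haarProbability G)) ∧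
      (∀ f, A' (Complex.ofRealCLM.compLpL 2 _ f) = Complex.ofRealCLM.compLpL 2 _ (A f)) ∧
      (∀ p f, X' p (Complex.ofRealCLM.compLpL 2 _ f) = Complex.ofRealCLM.compLpL 2 _ (X p f)) ∧
      (∀ v i, lam i ≠ 0 → U' v (Complex.ofRealCLM.compLpL 2 _ (b i)) ∈
        Submodule.span ℂ (Set.range fun j : {j : ι // lam j = lam i} =>
          (Complex.ofRealCLM.compLpL 2 (Measure.pi fun _ : FinSpatialSite S S S × Fin 3 => haarProbability G) (b j) :
            Lp ℂ 2 (Measure.pi fun _ : FinSpatialSite S S S × Fin 3 => haarProbability G)))) := by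
  -- abbreviations
  set μ : Measure (FinSpatialSite S S S × Fin 3 → G) := Measure.pi fun _ : FinSpatialSite S S S × Fin 3 => haarProbability G
  have hK := stronglyMeasurable_uncurry_finTorusSliceKernel (b₁ := S) (b₂ := S) (b₃ := S) ρ hρ β
  obtain ⟨CK, hCK⟩ := exists_norm_finTorusSliceKernel_le (b₁ := S) (b₂ := S) (b₃ := S) ρ hρ β
  have hsymm := finTorusSliceKernel_symm (b₁ := S) (b₂ := S) (b₃ := S) ρ hρu β
  -- (1) the real transfer operator and an eigenbasis
  obtain ⟨A, hA⟩ := exists_kernelOp (μ := μ) hK hCK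
  have hsa : IsSelfAdjoint A := isSelfAdjoint_kernelOp hK hCK hsymm hA
  have hC0 : 0 ≤ CK := (norm_nonneg _).trans (hCK 1 1)
  have hcpt : IsCompactOperator A := isCompactOperator_kernelOp hCK hC0 hA
  obtain ⟨ι, b, lam, hbs, hb0⟩ := exists_hilbertBasis_eigenvectors_of_isSelfAdjoint hcpt hsa
  have hb : ∀ i, A (b i) = lam i • b i := fun i => by simpa using hb0 i
  haveI : Fact ((2 : ℝ≥0∞) ≠ ⊤) := ⟨ENNReal.ofNat_ne_top⟩
  have hon : Orthonormal ℝ ((↑) : ι → Lp ℝ 2 μ) := hbs ▸ b.orthonormal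
  have hcnt : Countable ι := (hon.countable_of_separableSpace (𝕜 := ℝ)).to_subtype
  haveI : Countable ι := hcnt
  have hlam0 : ∀ i, 0 ≤ lam i := fun i => by
    rw [lam_eq_inner hb i]
    exact inner_kernelOp_self_nonneg hA (posType_finTorusSliceKernel ρ hρ hρu hβ) _
  have hS2 : Summable (fun i => lam i ^ 2) := (hasSum_lam_sq hK hCK hA hb).summable
  have hZ : ∀ m : ℕ, HasSum (fun i => lam i ^ (m + 2)) (wilsonFinTorusPartition ρ β S S S (m + 2)) := fun m => by
    rw [wilsonFinTorusPartition_eq_integral_prod_finTorusSliceKernel_succ ρ hρ β S S S m]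
    exact hasSum_pow_integral_cyclic hK hCK hsymm hA hb hlam0 m
  have hAsym : ∀ f f' : Lp ℝ 2 μ, ⟪A f, f'⟫_ℝ = ⟪f, A f'⟫_ℝ := fun f f' => hsa.isSymmetric f f'
  -- (2) real translations (K1) and bond operators (K3)
  obtain ⟨U, hUae, hU0, hUadd, hUnorm, hUA⟩ := TorusKLSliceTranslations.exists_translationOps (S := S) ρ β A hA
  choose X hX using fun p : FinSpatialSite S S S => exists_siteBondOp (S := S) ρ β hρ hρu hβ p
  -- (3) the complex operators
  have hKc := stronglyMeasurable_ofReal_kernel hK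
  have hCKc := norm_ofReal_kernel_le hCK
  obtain ⟨A', hA'⟩ := exists_kernelOp_rclike (𝕜 := ℂ) (μ := μ) hKc hCKc
  have hXcex : ∀ p : FinSpatialSite S S S, ∃ Xp : Lp ℂ 2 μ →L[ℂ] Lp ℂ 2 μ,
      ∀ g, (Xp g : (FinSpatialSite S S S × Fin 3 → G) → ℂ) =ᵐ[μ] fun u => ∫ u', ((siteBondKernel ρ β p u u' : ℝ) : ℂ) * g u' ∂μ :=
    fun p => exists_kernelOp_rclike (𝕜 := ℂ) (μ := μ) (stronglyMeasurable_ofReal_kernel (stronglyMeasurable_siteBondKernel ρ β hρ p))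
      (norm_ofReal_kernel_le (norm_siteBondKernel_le ρ β hρ hρu hβ p))
  choose X' hX' using hXcex
  have hτ : ∀ v : FinSpatialSite S S S, MeasurePreserving
      (fun (a : FinSpatialSite S S S × Fin 3 → G) (l : FinSpatialSite S S S × Fin 3) => a (l.1 + v, l.2)) μ μ :=
    fun v => TorusKLSliceTranslations.measurePreserving_sliceTranslate (haarProbability G) v
  set U' : FinSpatialSite S S S → (Lp ℂ 2 μ →L[ℂ] Lp ℂ 2 μ) := fun v =>
    (Lp.compMeasurePreservingₗᵢ ℂ (fun (a : FinSpatialSite S S S × Fin 3 → G) (l : FinSpatialSite S S S × Fin 3) =>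
      a (l.1 + v, l.2)) (hτ v)).toContinuousLinearMap with hU'def
  have hU'ae : ∀ v g, (U' v g : (FinSpatialSite S S S × Fin 3 → G) → ℂ) =ᵐ[μ]
      fun a => g (fun l : FinSpatialSite S S S × Fin 3 => a (l.1 + v, l.2)) :=
    fun v g => Lp.coeFn_compMeasurePreserving g (hτ v)
  -- complexification relations
  have hAJ : ∀ f, A' (Complex.ofRealCLM.compLpL 2 μ f) = Complex.ofRealCLM.compLpL 2 μ (A f) :=
    kernelOp_complex_ofRealLp hK hCK hA hA'
  have hXJ : ∀ p f, X' p (Complex.ofRealCLM.compLpL 2 μ f) = Complex.ofRealCLM.compLpL 2 μ (X p f) :=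
    fun p => kernelOp_complex_ofRealLp (stronglyMeasurable_siteBondKernel ρ β hρ p) (norm_siteBondKernel_le ρ β hρ hρu hβ p) (hX p) (hX' p)
  have hUJ : ∀ v f, U' v (Complex.ofRealCLM.compLpL 2 μ f) = Complex.ofRealCLM.compLpL 2 μ (U v f) :=
    fun v => compOp_complex_ofRealLp (hτ v).quasiMeasurePreserving (hUae v) (hU'ae v)
  -- properties of `A'`
  have hA'sa : IsSelfAdjoint A' := isSelfAdjoint_of_ae_hermitianKernel hKc hCKc (ofReal_kernel_hermitian hsymm) hA'
  have hA'c : IsCompactOperator A' := isCompactOperator_of_ae_kernel hCKc hC0 hA'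
  have hA'pos : ∀ g, 0 ≤ RCLike.re ⟪A' g, g⟫_ℂ := fun g => by
    refine re_inner_kernelOp_complex_nonneg hK hCK hA hA' (fun f => ?_) hAsym g
    rw [hAsym]; exact inner_kernelOp_self_nonneg hA (posType_finTorusSliceKernel ρ hρ hρu hβ) f
  -- properties of `U'`
  have hU'0 : U' 0 = 1 := eq_of_comp_ofRealLp fun f => by rw [hUJ, hU0]; rfl
  have hU'add : ∀ v w, U' (v + w) = U' v * U' w := fun v w => eq_of_comp_ofRealLp fun f => by
    rw [hUJ, hUadd, mul_comp_ofRealLp (hUJ v) (hUJ w)]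
  have hU'norm : ∀ v g, ‖U' v g‖ = ‖g‖ := fun v g => (Lp.compMeasurePreservingₗᵢ ℂ _ (hτ v)).norm_map g
  have hU'A : ∀ v, A' * U' v = U' v * A' := fun v =>
    eq_of_comp_ofRealLp fun f => by rw [mul_comp_ofRealLp hAJ (hUJ v), mul_comp_ofRealLp (hUJ v) hAJ, hUA]
  have hX'U : ∀ p v, X' (p + v) * U' v = U' v * X' p := fun p v => eq_of_comp_ofRealLp fun f => by
    rw [mul_comp_ofRealLp (hXJ (p + v)) (hUJ v), mul_comp_ofRealLp (hUJ v) (hXJ p),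
      siteBondOp_translate ρ β p v (hUae v) (hX p) (hX (p + v))]
  -- invariance of the eigenvalue classes under the translations
  have hUinv : ∀ v i, lam i ≠ 0 → U' v (Complex.ofRealCLM.compLpL 2 μ (b i)) ∈
      Submodule.span ℂ (Set.range fun j : {j : ι // lam j = lam i} => (Complex.ofRealCLM.compLpL 2 μ (b j) : Lp ℂ 2 μ)) := by
    intro v i h0
    classical
    have hfin : Set.Finite {j : ι | lam j = lam i} := finite_fibre hS2 h0
    -- `U bᵢ` is a real eigenvector for `λᵢ`, hence a finite combination of the `bⱼ`, `λⱼ = λᵢ`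
    have hev : A (U v (b i)) = lam i • U v (b i) := by
      rw [← mul_apply_eq_comp, hUA, mul_apply_eq_comp, hb, map_smul]
    rw [hUJ]
    have hs : ∀ j, lam j = lam i → j ∈ hfin.toFinset := fun j hj => by simpa using hj
    rw [eq_sum_fibre_of_eigenvector hb hAsym hs hev, map_sum]
    refine Submodule.sum_mem _ fun j hj => ?_
    rw [ofRealLp_smul]
    exact Submodule.smul_mem _ _ (Submodule.subset_span ⟨⟨j, by simpa using hj⟩, rfl⟩)
  exact ⟨A, X, ι, hcnt, b, lam, A', U', X', hA, hX, hb, hlam0, hS2, hZ, hAsym, hA'sa, hA'c, hA'pos, hU'0, hU'add, hU'norm, hU'A,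
    hX'U, hA', hAJ, hXJ, hUinv⟩

/-! ## §2 Regrouping spectral sums by eigenvalue classes -/

omit [NeZero S] in
/-- **Regrouping a spectral sum over the positive eigenvalue classes.**  If `Σᵢ f i = a` (unconditionally), `λᵢ ≥ 0`, `f i = 0`
whenever `λᵢ = 0`, and `s c` is the (finite) fibre of the class `c > 0`, then `Σ_{c} Σ_{i ∈ s c} f i = a` as a sum over the classes
`{c > 0} ∩ range λ` (`HasSum.tsum_fiberwise` along `i ↦ λᵢ`; the other fibres contribute nothing). [folklore] -/
theorem hasSum_classes {ι : Type*} {f : ι → ℝ} {a : ℝ} (hf : HasSum f a) (lam : ι → ℝ) (hlam0 : ∀ i, 0 ≤ lam i)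
    (hzero : ∀ i, lam i = 0 → f i = 0) (s : ({c : ℝ | 0 < c ∧ c ∈ Set.range lam} : Set ℝ) → Finset ι)
    (hs : ∀ c i, i ∈ s c ↔ lam i = c) :
    HasSum (fun c : ({c : ℝ | 0 < c ∧ c ∈ Set.range lam} : Set ℝ) => ∑ i ∈ s c, f i) a := by
  classical
  have h1 := hf.tsum_fiberwise lam
  have hsupp : Function.support (fun c : ℝ => ∑' i : lam ⁻¹' {c}, f i) ⊆ {c : ℝ | 0 < c ∧ c ∈ Set.range lam} := by
    intro c hc
    rw [Function.mem_support] at hc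
    by_contra hnot
    apply hc
    by_cases hr : c ∈ Set.range lam
    · have hle : ¬ 0 < c := fun h => hnot ⟨h, hr⟩
      obtain ⟨i, rfl⟩ := hr
      have h0 : lam i = 0 := le_antisymm (not_lt.1 hle) (hlam0 i)
      refine (tsum_congr fun j => ?_).trans tsum_zero
      have hj : lam j = lam i := j.2
      exact hzero j (by rw [hj, h0])
    · haveI : IsEmpty (lam ⁻¹' {c}) := ⟨fun j => hr ⟨j, j.2⟩⟩
      exact tsum_empty
  have h2 := (hasSum_subtype_iff_of_support_subset hsupp).2 h1
  have hfun : ((fun c : ℝ => ∑' i : lam ⁻¹' {c}, f i) ∘ ((↑) : {c : ℝ | 0 < c ∧ c ∈ Set.range lam} → ℝ)) =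
      fun c : ({c : ℝ | 0 < c ∧ c ∈ Set.range lam} : Set ℝ) => ∑ i ∈ s c, f i := by
    funext c
    simp only [Function.comp_apply]
    haveI : Fintype (lam ⁻¹' {(c : ℝ)}) := Fintype.ofFinset (s c) (fun i => by rw [hs]; rfl)
    rw [tsum_fintype, ← Finset.sum_subtype (s c) (fun i => by rw [hs]; rfl)]
  rw [hfun] at h2
  exact h2

/-- Powers of a complexification are complexifications of powers. [folklore] -/
theorem pow_comp_ofRealLp {X : Type*} [MeasurableSpace X] {μ : Measure X} {T' : Lp ℂ 2 μ →L[ℂ] Lp ℂ 2 μ}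
    {T : Lp ℝ 2 μ →L[ℝ] Lp ℝ 2 μ} (h : ∀ f, T' (Complex.ofRealCLM.compLpL 2 μ f) = Complex.ofRealCLM.compLpL 2 μ (T f)) (n : ℕ)
    (f : Lp ℝ 2 μ) : (T' ^ n) (Complex.ofRealCLM.compLpL 2 μ f) = Complex.ofRealCLM.compLpL 2 μ ((T ^ n) f) := by
  induction n with
  | zero => simp
  | succ n ih => rw [pow_succ', pow_succ', mul_apply_eq_comp, mul_apply_eq_comp, ih, h]

/-! ## §3 The complex spectral package -/

/-- ★ **THE COMPLEX SPECTRAL PACKAGE OF THE `Fin`-TORUS.**  On `H = L²(slices; ℂ)`: the transfer operator `A'` (self-adjoint, compact,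
positive), the norm-preserving spatial translations `U'` commuting with it, the bond operators `X'_p` (`X'_{p+v} U'_v = U'_v X'_p`); a
countable set `C ⊆ (0, ∞)` of eigenvalue classes and for each class a finite orthonormal family `e c` of JOINT EIGENVECTORS
(`A' e = c e`, `U'_{v(γ)} e = χ_q(γ) e` with the bicharacter `χ` of `(ℤ/S)³`); and the spectral identities of the torus as sums over
the classes: `Z(m+2) = Σ_c c^{m+2} |e c|`, the one-point functions `∫ A((p,t),U) e^{−βS} = Σ_c c^{T−1} Σ_k ⟪e c k, X'_p (e c k)⟫ =
∫ A((p,t),θU) e^{−βS}` (`T = M + 3`), and the site-resolved two-point function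
`∫ A((p',t'),U) A((p,t),θU) e^{−βS} = Σ_c c^{a+1} Σ_k ⟪X'_p (e c k), A'^{b'+2} X'_{p'} (e c k)⟫` (`K = a + b' + 4`, `1 ≤ t`, `t + t' = b' + 2`).
[cite: Luscher1977] [cite: MontvayMunster1994, §3.2.6 (3.145)] [cite: ReedSimonI1980, Thm VI.23] -/
theorem exists_complex_spectral_package (hρ : Continuous ρ) (hρu : ∀ g, ρ g ∈ Matrix.unitaryGroup (Fin N) ℂ) (hβ : 0 ≤ β) :
    ∃ (A' : Lp ℂ 2 (Measure.pi fun _ : FinSpatialSite S S S × Fin 3 => haarProbability G) →L[ℂ]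
        Lp ℂ 2 (Measure.pi fun _ : FinSpatialSite S S S × Fin 3 => haarProbability G))
      (U' : FinSpatialSite S S S → Lp ℂ 2 (Measure.pi fun _ : FinSpatialSite S S S × Fin 3 => haarProbability G) →L[ℂ]
        Lp ℂ 2 (Measure.pi fun _ : FinSpatialSite S S S × Fin 3 => haarProbability G))
      (X' : FinSpatialSite S S S → Lp ℂ 2 (Measure.pi fun _ : FinSpatialSite S S S × Fin 3 => haarProbability G) →L[ℂ]
        Lp ℂ 2 (Measure.pi fun _ : FinSpatialSite S S S × Fin 3 => haarProbability G))
      (C : Set ℝ) (_ : C.Countable) (d : C → (Fin 3 → ZMod S) → ℕ)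
      (e : (c : C) → (Σ q : Fin 3 → ZMod S, Fin (d c q)) →
        Lp ℂ 2 (Measure.pi fun _ : FinSpatialSite S S S × Fin 3 => haarProbability G)),
      IsSelfAdjoint A' ∧ IsCompactOperator A' ∧ (∀ g, 0 ≤ RCLike.re ⟪A' g, g⟫_ℂ) ∧
      U' 0 = 1 ∧ (∀ v w, U' (v + w) = U' v * U' w) ∧ (∀ v g, ‖U' v g‖ = ‖g‖) ∧ (∀ v, A' * U' v = U' v * A') ∧
      (∀ p v, X' (p + v) * U' v = U' v * X' p) ∧
      (∀ c : C, 0 < (c : ℝ)) ∧ (∀ c, Orthonormal ℂ (e c)) ∧ (∀ c k, A' (e c k) = ((c : ℝ) : ℂ) • e c k) ∧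
      (∀ c k (γ : Fin 3 → ZMod S),
        U' ((ZMod.finEquiv S).symm (γ 0), (ZMod.finEquiv S).symm (γ 1), (ZMod.finEquiv S).symm (γ 2)) (e c k) =
          (∏ j, ZMod.stdAddChar (k.1 j * γ j)) • e c k) ∧
      (∀ m : ℕ, HasSum (fun c : C => (c : ℝ) ^ (m + 2) * (Fintype.card (Σ q : Fin 3 → ZMod S, Fin (d c q)) : ℝ))
        (wilsonFinTorusPartition ρ β S S S (m + 2))) ∧
      (∀ (T M : ℕ) (_ : T = M + 3) (p : FinSpatialSite S S S) (t : Fin T),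
        HasSum (fun c : C => ((c : ℝ) : ℂ) ^ (M + 2) * ∑ k, ⟪e c k, X' p (e c k)⟫_ℂ)
          ((∫ U : FinTorusSite S S S T × Fin 4 → G,
            (∑ q : {q : Fin 4 × Fin 4 // q.1 < q.2}, (ρ (finTorusPlaquette U (p.toSite t) q.1.1 q.1.2)).trace.re) *
              Real.exp (-β * ∑ x : FinTorusSite S S S T, ∑ q : {q : Fin 4 × Fin 4 // q.1 < q.2},
                ((N : ℝ) - (ρ (finTorusPlaquette U x q.1.1 q.1.2)).trace.re))
            ∂(Measure.pi fun _ : FinTorusSite S S S T × Fin 4 => haarProbability G) : ℝ) : ℂ)) ∧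
      (∀ (T M : ℕ) (_ : T = M + 3) (p : FinSpatialSite S S S) (t : Fin T),
        HasSum (fun c : C => ((c : ℝ) : ℂ) ^ (M + 2) * ∑ k, ⟪e c k, X' p (e c k)⟫_ℂ)
          ((∫ U : FinTorusSite S S S T × Fin 4 → G,
            (∑ q : {q : Fin 4 × Fin 4 // q.1 < q.2}, (ρ (finTorusPlaquette
                (fun e : FinTorusSite S S S T × Fin 4 => if e.2 = Fin.last 3 then
                  (U ((e.1.1, e.1.2.1, e.1.2.2.1, Fin.rev e.1.2.2.2), Fin.last 3))⁻¹
                else U ((e.1.1, e.1.2.1, e.1.2.2.1, ⟨(T - e.1.2.2.2.val) % T, Nat.mod_lt _ e.1.2.2.2.pos⟩), e.2))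
                (p.toSite t) q.1.1 q.1.2)).trace.re) *
              Real.exp (-β * ∑ x : FinTorusSite S S S T, ∑ q : {q : Fin 4 × Fin 4 // q.1 < q.2},
                ((N : ℝ) - (ρ (finTorusPlaquette U x q.1.1 q.1.2)).trace.re))
            ∂(Measure.pi fun _ : FinTorusSite S S S T × Fin 4 => haarProbability G) : ℝ) : ℂ)) ∧
      (∀ (a b' K : ℕ) (_ : K = a + b' + 4) (p p' : FinSpatialSite S S S) (t t' : Fin (K + 1)) (_ : 1 ≤ (t : ℕ))
        (_ : (t : ℕ) + t' = b' + 2),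
        HasSum (fun c : C => ((c : ℝ) : ℂ) ^ (a + 1) * ∑ k, ⟪X' p (e c k), (A' ^ (b' + 2)) (X' p' (e c k))⟫_ℂ)
          ((∫ U : FinTorusSite S S S (K + 1) × Fin 4 → G,
            ((∑ q : {q : Fin 4 × Fin 4 // q.1 < q.2}, (ρ (finTorusPlaquette U (p'.toSite t') q.1.1 q.1.2)).trace.re) *
              ∑ q : {q : Fin 4 × Fin 4 // q.1 < q.2}, (ρ (finTorusPlaquette
                (fun e : FinTorusSite S S S (K + 1) × Fin 4 => if e.2 = Fin.last 3 then
                  (U ((e.1.1, e.1.2.1, e.1.2.2.1, Fin.rev e.1.2.2.2), Fin.last 3))⁻¹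
                else U ((e.1.1, e.1.2.1, e.1.2.2.1, ⟨(K + 1 - e.1.2.2.2.val) % (K + 1), Nat.mod_lt _ e.1.2.2.2.pos⟩), e.2))
                (p.toSite t) q.1.1 q.1.2)).trace.re) *
              Real.exp (-β * ∑ x : FinTorusSite S S S (K + 1), ∑ q : {q : Fin 4 × Fin 4 // q.1 < q.2},
                ((N : ℝ) - (ρ (finTorusPlaquette U x q.1.1 q.1.2)).trace.re))
            ∂(Measure.pi fun _ : FinTorusSite S S S (K + 1) × Fin 4 => haarProbability G) : ℝ) : ℂ)) := by
  classical
  set μ : Measure (FinSpatialSite S S S × Fin 3 → G) := Measure.pi fun _ : FinSpatialSite S S S × Fin 3 => haarProbability G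
  have hK := stronglyMeasurable_uncurry_finTorusSliceKernel (b₁ := S) (b₂ := S) (b₃ := S) ρ hρ β
  obtain ⟨CK, hCK⟩ := exists_norm_finTorusSliceKernel_le (b₁ := S) (b₂ := S) (b₃ := S) ρ hρ β
  obtain ⟨A, X, ι, hcnt, b, lam, A', U', X', hA, hX, hb, hlam0, hS2, hZ, hAsym, hA'sa, hA'c, hA'pos, hU'0, hU'add, hU'norm, hU'A,
    hX'U, hA', hAJ, hXJ, hUinv⟩ := exists_complex_operators (S := S) ρ β hρ hρu hβ
  haveI : Countable ι := hcnt
  -- the classes and their fibres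
  have hCcnt : ({c : ℝ | 0 < c ∧ c ∈ Set.range lam} : Set ℝ).Countable := (Set.countable_range lam).mono fun c hc => hc.2
  have hCpos : ∀ c : ({c : ℝ | 0 < c ∧ c ∈ Set.range lam} : Set ℝ), 0 < (c : ℝ) := fun c => c.2.1
  have hfin := fun c : ({c : ℝ | 0 < c ∧ c ∈ Set.range lam} : Set ℝ) => finite_fibre hS2 (c := (c : ℝ)) (hCpos c).ne'
  obtain ⟨s, hs_def⟩ : ∃ s : ({c : ℝ | 0 < c ∧ c ∈ Set.range lam} : Set ℝ) → Finset ι, s = fun c => (hfin c).toFinset :=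
    ⟨_, rfl⟩
  have hs : ∀ (c : ({c : ℝ | 0 < c ∧ c ∈ Set.range lam} : Set ℝ)) i, i ∈ s c ↔ lam i = c := fun c i => by simp [hs_def]
  -- the translations indexed by `(ℤ/S)³`
  obtain ⟨toΓ, htoΓ⟩ : ∃ toΓ : (Fin 3 → ZMod S) → FinSpatialSite S S S, toΓ = fun γ =>
    ((ZMod.finEquiv S).symm (γ 0), (ZMod.finEquiv S).symm (γ 1), (ZMod.finEquiv S).symm (γ 2)) := ⟨_, rfl⟩
  have htoΓ0 : toΓ 0 = 0 := by simp only [htoΓ, Pi.zero_apply, map_zero]; rfl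
  have htoΓadd : ∀ γ γ', toΓ (γ + γ') = toΓ γ + toΓ γ' := fun γ γ' => by simp only [htoΓ, Pi.add_apply, map_add]; rfl
  obtain ⟨V, hV⟩ : ∃ V : (Fin 3 → ZMod S) → Lp ℂ 2 μ →L[ℂ] Lp ℂ 2 μ, V = fun γ => U' (toΓ γ) := ⟨_, rfl⟩
  have hV0 : V 0 = 1 := by rw [hV]; show U' (toΓ 0) = 1; rw [htoΓ0, hU'0]
  have hVadd : ∀ γ γ', V (γ + γ') = V γ * V γ' := fun γ γ' => by
    rw [hV]; show U' (toΓ (γ + γ')) = U' (toΓ γ) * U' (toΓ γ'); rw [htoΓadd, hU'add]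
  have hVnorm : ∀ γ g, ‖V γ g‖ = ‖g‖ := fun γ g => by rw [hV]; exact hU'norm _ g
  -- the complexified basis vectors are orthonormal
  have hJon : Orthonormal ℂ fun i : ι => (Complex.ofRealCLM.compLpL 2 μ (b i) : Lp ℂ 2 μ) := orthonormal_ofRealLp b.orthonormal
  -- adapted families, class by class
  have key : ∀ c : ({c : ℝ | 0 < c ∧ c ∈ Set.range lam} : Set ℝ), ∃ (d : (Fin 3 → ZMod S) → ℕ) (e : (Σ q : Fin 3 → ZMod S, Fin (d q)) → Lp ℂ 2 μ),
      Orthonormal ℂ e ∧ (∀ k, e k ∈ Submodule.span ℂ ((fun i : ι => (Complex.ofRealCLM.compLpL 2 μ (b i) : Lp ℂ 2 μ)) '' (s c : Set ι))) ∧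
      (∀ k γ, V γ (e k) = (∏ j, ZMod.stdAddChar (k.1 j * γ j)) • e k) ∧
      ∀ T : Lp ℂ 2 μ →L[ℂ] Lp ℂ 2 μ, ∑ k, ⟪e k, T (e k)⟫_ℂ = ∑ i ∈ s c, ⟪(Complex.ofRealCLM.compLpL 2 μ (b i) : Lp ℂ 2 μ),
        T (Complex.ofRealCLM.compLpL 2 μ (b i))⟫_ℂ := by
    intro c
    refine AdaptedBasis.exists_adapted_orthonormal_family (fun q γ : Fin 3 → ZMod S => ∏ j, ZMod.stdAddChar (q j * γ j)) V
      SqueezedSkewnessJointDiagonal.bichar_add SqueezedSkewnessJointDiagonal.bichar_conj SqueezedSkewnessJointDiagonal.bichar_orth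
      SqueezedSkewnessJointDiagonal.bichar_dual hV0 hVadd hVnorm hJon (s c) fun γ i hi => ?_
    -- invariance of the class span
    have hi' : lam i = c := (hs c i).1 hi
    have h := hUinv (toΓ γ) i (by rw [hi']; exact (hCpos c).ne')
    have hset : (Set.range fun j : {j : ι // lam j = lam i} => (Complex.ofRealCLM.compLpL 2 μ (b j) : Lp ℂ 2 μ)) =
        (fun i : ι => (Complex.ofRealCLM.compLpL 2 μ (b i) : Lp ℂ 2 μ)) '' (s c : Set ι) := by
      ext g
      simp only [Set.mem_range, Set.mem_image, Finset.mem_coe, hs, Subtype.exists, hi', exists_prop]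
    rw [hset] at h
    rw [hV]
    exact h
  choose d e horth hmem heig htrace using key
  -- eigenvectors of `A'`
  have hAe : ∀ c k, A' (e c k) = ((c : ℝ) : ℂ) • e c k := by
    intro c k
    refine apply_eq_smul_of_mem_span_fibre hK hCK hA hA' hb (s := s c) (fun i hi => (hs c i).1 hi) ?_
    have h := hmem c k
    rw [Set.image_eq_range] at h
    exact h
  -- matrix elements on the complexified basis
  have hJJ : ∀ f f' : Lp ℝ 2 μ, ⟪(Complex.ofRealCLM.compLpL 2 μ f : Lp ℂ 2 μ), Complex.ofRealCLM.compLpL 2 μ f'⟫_ℂ =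
      ((⟪f, f'⟫_ℝ : ℝ) : ℂ) := inner_ofRealLp_ofRealLp
  have hcard : ∀ c : ({c : ℝ | 0 < c ∧ c ∈ Set.range lam} : Set ℝ), (Fintype.card (Σ q : Fin 3 → ZMod S, Fin (d c q)) : ℂ) = ((s c).card : ℂ) := by
    intro c
    have h := htrace c 1
    simp only [one_apply_eq_self] at h
    have h1 : ∀ k, ⟪e c k, e c k⟫_ℂ = 1 := fun k => by
      rw [inner_self_eq_norm_sq_to_K, (horth c).norm_eq_one]; simp
    have h2 : ∀ i, ⟪(Complex.ofRealCLM.compLpL 2 μ (b i) : Lp ℂ 2 μ), Complex.ofRealCLM.compLpL 2 μ (b i)⟫_ℂ = 1 := fun i => by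
      rw [hJJ, real_inner_self_eq_norm_sq, b.orthonormal.norm_eq_one]; simp
    simp only [h1, h2, Finset.sum_const, Finset.card_univ, nsmul_eq_mul, mul_one] at h
    exact h
  have hT1 : ∀ (c : ({c : ℝ | 0 < c ∧ c ∈ Set.range lam} : Set ℝ)) p, ∑ k, ⟪e c k, X' p (e c k)⟫_ℂ = ∑ i ∈ s c, ((⟪b i, X p (b i)⟫_ℝ : ℝ) : ℂ) := by
    intro c p
    rw [htrace c (X' p)]
    refine Finset.sum_congr rfl fun i _ => ?_
    rw [hXJ, hJJ]
  have hT2 : ∀ (c : ({c : ℝ | 0 < c ∧ c ∈ Set.range lam} : Set ℝ)) p p' (n : ℕ), ∑ k, ⟪X' p (e c k), (A' ^ n) (X' p' (e c k))⟫_ℂ =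
      ∑ i ∈ s c, ((⟪X p (b i), (A ^ n) (X p' (b i))⟫_ℝ : ℝ) : ℂ) := by
    intro c p p' n
    have hApow : ∀ f, (A' ^ n) (Complex.ofRealCLM.compLpL 2 μ f) = Complex.ofRealCLM.compLpL 2 μ ((A ^ n) f) :=
      pow_comp_ofRealLp hAJ n
    obtain ⟨T, hT⟩ : ∃ T : Lp ℂ 2 μ →L[ℂ] Lp ℂ 2 μ, T = ContinuousLinearMap.adjoint (X' p) * ((A' ^ n) * X' p') := ⟨_, rfl⟩
    have hTe : ∀ g : Lp ℂ 2 μ, ⟪g, T g⟫_ℂ = ⟪X' p g, (A' ^ n) (X' p' g)⟫_ℂ := fun g => by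
      rw [hT, mul_apply_eq_comp, mul_apply_eq_comp, ContinuousLinearMap.adjoint_inner_right]
    have h := htrace c T
    simp only [hTe] at h
    rw [h]
    refine Finset.sum_congr rfl fun i _ => ?_
    rw [hXJ, hXJ, hApow, hJJ]
  -- class sums of powers
  have hpow : ∀ (c : ({c : ℝ | 0 < c ∧ c ∈ Set.range lam} : Set ℝ)) (n : ℕ) (g : ι → ℝ), ∑ i ∈ s c, lam i ^ n * g i = (c : ℝ) ^ n * ∑ i ∈ s c, g i := by
    intro c n g
    rw [Finset.mul_sum]
    refine Finset.sum_congr rfl fun i hi => ?_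
    rw [(hs c i).1 hi]
  refine ⟨A', U', X', {c : ℝ | 0 < c ∧ c ∈ Set.range lam}, hCcnt, d, e, hA'sa, hA'c, hA'pos, hU'0, hU'add, hU'norm, hU'A, hX'U, hCpos, horth, hAe,
    fun c k γ => by have h := heig c k γ; rw [hV, htoΓ] at h; exact h, fun m => ?_, fun T M hT p t => ?_, fun T M hT p t => ?_, fun a b' K hK' p p' t t' ht htt => ?_⟩
  · -- the trace formula over the classes
    have h := hasSum_classes (hZ m) lam hlam0 (fun i hi => by rw [hi, zero_pow (by omega)]) s hs
    have hfun : (fun c : ({c : ℝ | 0 < c ∧ c ∈ Set.range lam} : Set ℝ) => ∑ i ∈ s c, lam i ^ (m + 2)) =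
        fun c : ({c : ℝ | 0 < c ∧ c ∈ Set.range lam} : Set ℝ) => (c : ℝ) ^ (m + 2) * (Fintype.card (Σ q : Fin 3 → ZMod S, Fin (d c q)) : ℝ) := by
      funext c
      have h1 := hpow c (m + 2) (fun _ => 1)
      simp only [mul_one, Finset.sum_const, nsmul_eq_mul] at h1
      rw [h1]
      have h2 := hcard c
      norm_cast at h2
      rw [h2]
    rw [hfun] at h; exact h
  · -- one point
    have h := hasSum_classes (hasSum_site_onePoint ρ β hρ hρu hβ hT p t hA hb (hX p)) lam hlam0
      (fun i hi => by rw [hi, zero_pow (by omega), zero_mul]) s hs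
    have h' := (Complex.hasSum_ofReal (L := SummationFilter.unconditional _)).2 h
    have hfun : (fun c : ({c : ℝ | 0 < c ∧ c ∈ Set.range lam} : Set ℝ) => (((∑ i ∈ s c, lam i ^ (M + 2) * ⟪b i, X p (b i)⟫_ℝ) : ℝ) : ℂ)) =
        fun c : ({c : ℝ | 0 < c ∧ c ∈ Set.range lam} : Set ℝ) => ((c : ℝ) : ℂ) ^ (M + 2) * ∑ k, ⟪e c k, X' p (e c k)⟫_ℂ := by
      funext c; rw [hpow, hT1]; push_cast; rfl
    rw [hfun] at h'; exact h'
  · -- reflected one point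
    have h := hasSum_classes (hasSum_site_onePoint_refl ρ β hρ hρu hβ hT p t hA hb (hX p)) lam hlam0
      (fun i hi => by rw [hi, zero_pow (by omega), zero_mul]) s hs
    have h' := (Complex.hasSum_ofReal (L := SummationFilter.unconditional _)).2 h
    have hfun : (fun c : ({c : ℝ | 0 < c ∧ c ∈ Set.range lam} : Set ℝ) => (((∑ i ∈ s c, lam i ^ (M + 2) * ⟪b i, X p (b i)⟫_ℝ) : ℝ) : ℂ)) =
        fun c : ({c : ℝ | 0 < c ∧ c ∈ Set.range lam} : Set ℝ) => ((c : ℝ) : ℂ) ^ (M + 2) * ∑ k, ⟪e c k, X' p (e c k)⟫_ℂ := by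
      funext c; rw [hpow, hT1]; push_cast; rfl
    rw [hfun] at h'; exact h'
  · -- two points
    have h := hasSum_classes (hasSum_site_twoPoint ρ β hρ hρu hβ hK' p p' t t' ht htt hA hb (hX p) (hX p')) lam hlam0
      (fun i hi => by rw [hi, zero_pow (by omega), zero_mul]) s hs
    have h' := (Complex.hasSum_ofReal (L := SummationFilter.unconditional _)).2 h
    have hfun : (fun c : ({c : ℝ | 0 < c ∧ c ∈ Set.range lam} : Set ℝ) => (((∑ i ∈ s c, lam i ^ (a + 1) * ⟪X p (b i), (A ^ (b' + 2)) (X p' (b i))⟫_ℝ) : ℝ) : ℂ)) =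
        fun c : ({c : ℝ | 0 < c ∧ c ∈ Set.range lam} : Set ℝ) => ((c : ℝ) : ℂ) ^ (a + 1) * ∑ k, ⟪X' p (e c k), (A' ^ (b' + 2)) (X' p' (e c k))⟫_ℂ := by
      funext c; rw [hpow, hT2]; push_cast; rfl
    rw [hfun] at h'; exact h'

end Summit.QuantumFields.YangMills.Theorems.TorusKL

end
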